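import Summits.Ventures.CertifiedManyBodySolver.Theorems.M3x2EdgeSplitSymReplayShardsB
import Summits.Ventures.CertifiedManyBodySolver.Theorems.M3x2EdgeSplitSymReplaySyntaxV
import HarnessLib

/-!
# SymReplay — ORBIT-REPRESENTATIVE Gram blocks («gramR»): syntax, kernel toy, and SOUNDNESS
(pen hub-lb-sym-plan-1 g2, 2026-08-28, rev 3; ADDITIVE module on the landed T1–T12b chain + `…SyntaxV` — nothing of
`…SymReplaySyntax … SymReplaySound / ShardsA / ShardsB / SyntaxV` is touched; crit-1 V80 (B) / V83 additive + one-writer rules).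

THE LEVER (checker COST, not a bound lever).  A Gram block of the v0′ certificate lives in one isotypic
component of the window's point group `K` (`D₄` about the window centre for the 68 `A`-type blocks, `D₂` for the
17 `E`-type blocks); every basis polynomial is `q_i = Σ_{g ∈ K} χ(g) · α_g(s_i)` for a one-dimensional
character `χ` and a SHORT representative `s_i` (2 938 representative words for 17 045 basis words on v0′,
checked element-wise in the CAR algebra: STATUS l.1317).  Since `α_g(q_j) = χ(g) q_j`,
`q_i† q_j = Σ_g α_g(s_i† q_j)` EXACTLY, so the block `P = λ Σ g_ij q_i† q_j` equals `|K| · D` MODULO LICENSED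
MOVES, `D := λ Σ g_ij s_i† q_j` — and the checker expands only `D` (1 456 545 products instead of 8 418 173,
÷5.78).  Nothing about groups or characters is trusted: the checker GENERATES `q_j` from the shipped `s_j` and
VERIFIES the eigen-property `α_m(q_j) = χ_m q_j` syntactically for every shipped move `m`; a passing check is
sound unconditionally.

CONTENTS.  `SyntaxR` (computable; needs only T1 + `…SyntaxV`): `RMove`, `GramBlockR`, `movePolyF`,
`genPre/genOne/genBasis/toGramBlock`, `eigenOK`, `gramBlockROK`, `gramBlockPolyR`, `SymCertR` (= `SymCert` + `gramR`),
`SymCertR.expand` (the ordinary certificate `K♯` with the generated blocks appended to `gramM` — never expanded by the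
checker), `rhsPolyR`, `residualR`, `identityOKR`, `symCheckR`, `symValueR`; the EXECUTED variant `identityOKRV` /
`symCheckRV` (canonicaliser `canonTermAV` of the landed `…SyntaxV`, integer-pair corner) with `symCheckRV_eq :
symCheckRV K = symCheckR K` (V83 pattern); the kernel toy `toyRCert` (value `−11/4`, two one-column R-blocks) checked
by `decide +kernel` through both.  `SemanticsR` (all PROVED, farm rc 0 · 0 sorry · 0 warnings): the block lemma
`polyOp (gramBlockPoly (toGramBlock B)) = polyOp (|moves| • D_B) + Σ uses`, `polyOp_rhsPoly_expand`, and
`symCheckR_sound : symCheckR K = true → WardD4CertGe (symValueR K)` — concluded by the LANDED expansion-form S4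
`wardD4CertGe_of_expansion` (T12a `…ShardsA`, hub-lb-sym-eng-3; single-sourced, no copy here) with the DERIVED use family
`usesR K` — whence `energyDensity_ge_symValueR : symCheckR K = true → symValueR K ≤ e₀(1, 0, 8, 7/8)` (no hypothesis) and
the end-to-end toy `toyRCert_energy_ge : −11/4 ≤ e₀(1, 0, 8, 7/8)` (axioms `propext / Classical.choice / Quot.sound`).
`ShardsR` (§(g), all PROVED): T12b's sharded-replay contract (`…ShardsB`, hub-lb-sym-eng-3) with `rhsPoly ↦ rhsPolyR` —
`shardPolysR K c := shardPolys K.toSymCert c ++ (R-block chunks by representatives)`, `sum_shardPolysR`, `shardOKR`/`ShardFactsR`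
(T12b's `canonNF`, `Facts₂`, `facts₂_sum` reused verbatim), `wardD4CertGe_of_shardsR` / `energyDensity_ge_of_shardsR`, the executed
pipe `canonNFAV` (= `canonNF`, via `canonTermAV_eq`) with `shardOKRV`/`ShardFactsRV`/`energyDensity_ge_of_shardsRV`, and the toy
`toyRCert` replayed in three R-shards (`toyRCert_energy_ge_sharded`, `decide +kernel` only, standard axioms).

HONEST FRAMING: a checker COST lever with its soundness theorem and a toy; no certificate beyond the toy is
replayed here; no bound of record moves; no summit or crux statement is proved here; nothing here predicts
superconductivity.
-/

/-! (Module 1/4 of the landed gramR text: `SyntaxR`.) Text: hub-lb-sym-plan-1 g2 (`Cruxes/LowerEdge_ge_m83o100/SymReplayGramR_symplan1.lean` rev 3, a26d6b87249c), landed verbatim by hub-lb-sym-eng-3. No summit or crux statement is proved here; no certificate beyond toys is replayed; nothing here predicts superconductivity. -/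

namespace Summit.Ventures.CertifiedManyBodySolver.Theorems.SymReplay

open Literature.Probability.LatticeModels

section SyntaxR

/-- Letterwise move of every word of a polynomial (flattened sites; `= movePolyW`, see `movePolyF_eq`). -/
def movePolyF (γ : DihedralGroup 4) (v : Site 2) (p : QPoly) : QPoly := p.map fun t => (t.1, moveWordF γ v t.2)

/-- `movePolyF` unfolds to the letterwise `moveWordF` map (`rfl`).  This is THE unfolding the soundness proofs
(`…GramRSoundA`) use, so that the executed body of `movePolyF` may be swapped for the `moveWordV` form of `…SyntaxV`
(compiled cost ×34 on a real R-block, hub-lb-sym-plan-1 `ProbeC022`) without touching any proof. -/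
theorem movePolyF_def (γ : DihedralGroup 4) (v : Site 2) (p : QPoly) :
    movePolyF γ v p = p.map fun t => (t.1, moveWordF γ v t.2) := rfl

/-- **Executed body for `movePolyF`**: the same letterwise move with every moved site rebuilt from two computed
integers (`moveWordV` of `…SyntaxV`; `moveWordV = moveWordF` is `rfl`).  Measured on the farm by hub-lb-sym-plan-1
(`ProbeC022`, block `mm.c0/22` of rung V: 3 904 moved generated words against the 625-site frame): support checks of
`moveWordF`-moved words 418 s vs 8 s with `moveWordV`, whole probe 539 s vs 15.9 s — T1's `flatSite` leaves the moved
site a closure under compiled evaluation, so every later coordinate access re-runs the move arithmetic. -/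
def movePolyFV (γ : DihedralGroup 4) (v : Site 2) (p : QPoly) : QPoly := p.map fun t => (t.1, moveWordV γ v t.2)

/-- `movePolyF = movePolyFV` (`rfl`), registered `@[csimp]`: the compiled code of every definition elaborated AFTER this
line that mentions `movePolyF` — `genPre`, `genOne`, `genBasis`, `toGramBlock`, `eigenOK`, `gramBlockROK`, `gramBlockPolyR`,
`rhsPolyR`, … below, hence everything of `…GramRShards` / `…GramRShardsFast` / `…GramRShardsLocal` built on them — calls
`movePolyFV`; the kernel, `decide +kernel` and every proof see `movePolyF` exactly as defined (nothing is restated;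
hub-lb-sym-eng-3 bench: a recompiled `genPre` on 120 eight-letter words × 2 moves × 625-site frame 1.2 s vs 9.3 s). -/
@[csimp] theorem movePolyF_eq_movePolyFV : @movePolyF = @movePolyFV := rfl

/-- A block move: the affine `D₄` move `x ↦ γx + v` together with the character value `χ` it acts by on the block's
basis polynomials. -/
structure RMove where
  γ : DihedralGroup 4
  v : Site 2
  χ : ℚ

/-- **Orbit-representative Gram block**: `scale`, the block's moves `(γ_m, v_m, χ_m)`, REPRESENTATIVES `s_i`
(the basis polynomial is GENERATED as `q_i := Σ_m χ_m · α_m(s_i)`, normal-ordered and collected), and the factor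
rows `L_i` exactly as in `GramBlock`. -/
structure GramBlockR where
  scale : ℚ
  moves : List RMove
  reps : List QPoly
  rows : List (List (ℚ × ℕ))

/-- `Σ_m χ_m · α_m(s)` before normal ordering. -/
def genPre (ms : List RMove) (s : QPoly) : QPoly := ms.flatMap fun m => pscale m.χ (movePolyF m.γ m.v s)

/-- The generated basis polynomial `q := collect (nf (Σ_m χ_m · α_m(s)))`. -/
def genOne (ms : List RMove) (s : QPoly) : QPoly := collect (nfPoly (genPre ms s))

/-- The generated basis of a block. -/
def genBasis (B : GramBlockR) : List QPoly := B.reps.map (genOne B.moves)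

/-- The ordinary Gram block the R-block STANDS FOR (PSD by `GramBlock` soundness; never expanded by the checker). -/
def toGramBlock (B : GramBlockR) : GramBlock := ⟨B.scale, genBasis B, B.rows⟩

/-- Syntactic eigen-check of one polynomial: for every move, the moved polynomial stays in the frame and
`nf(α_m q) − χ_m q` collects to zero. -/
def eigenOK (frame : List (Site 2)) (ms : List RMove) (q : QPoly) : Bool :=
  ms.all fun m => psuppIn (movePolyF m.γ m.v q) frame &&
    isZero (psub (nfPoly (movePolyF m.γ m.v q)) (pscale m.χ q))

/-- Side conditions of an R-block: one row per representative; representatives and all their move images in the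
frame; every generated basis polynomial passes the eigen-check. -/
def gramBlockROK (frame : List (Site 2)) (B : GramBlockR) : Bool :=
  B.reps.length == B.rows.length &&
    (B.reps.all fun s => psuppIn s frame && psuppIn (genPre B.moves s) frame) &&
    ((genBasis B).all fun q => eigenOK frame B.moves q)

/-- **The polynomial the checker expands**: `D_B := scale · Σ_{i,j : ⟨L_i,L_j⟩ ≠ 0} ⟨L_i, L_j⟩ · s_i† q_j`
(representatives on the left, generated basis on the right). -/
def gramBlockPolyR (B : GramBlockR) : QPoly :=
  let sr := B.reps.zip B.rows
  let qr := (genBasis B).zip B.rows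
  pscale B.scale (sr.flatMap fun a => qr.flatMap fun b =>
    let g := sdot a.2 b.2
    if g = 0 then [] else pscale g (pmul (padj a.1) b.1))

/-- A syntactic certificate with orbit-representative Gram blocks. -/
structure SymCertR extends SymCert where
  gramR : List GramBlockR

/-- The ordinary certificate `K♯` the R-certificate stands for: the generated blocks appended to `gramM`. -/
def SymCertR.expand (K : SymCertR) : SymCert :=
  { K.toSymCert with gramM := K.gramM ++ K.gramR.map toGramBlock }

/-- Right-hand side with the R-blocks in REPRESENTATIVE form: the ordinary slots, then `|moves_B| · D_B` per block. -/
def rhsPolyR (K : SymCertR) : QPoly :=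
  rhsPoly K.toSymCert ++ K.gramR.flatMap fun B => pscale (B.moves.length : ℚ) (gramBlockPolyR B)

/-- The collected normal form of `LHS − RHS_R`. -/
def residualR (K : SymCertR) : QPoly := collect (nfPoly (psub (lhsPoly K.toSymCert) (rhsPolyR K)))

/-- The identity test (same canonicaliser and corner as `identityOK`). -/
def identityOKR (K : SymCertR) : Bool :=
  let corner := flatSite (minCorner K.frame)
  isZero (if K.useCanon then (residualR K).flatMap (canonTermA corner K.frame) else residualR K)

/-- **The R-checker**: `K♯` well formed (cheap — the generated bases are small), R-block side conditions, identity. -/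
def symCheckR (K : SymCertR) : Bool :=
  wellFormed K.expand && K.gramR.all (gramBlockROK K.frame) && identityOKR K

/-- The certified value (`= symValue K♯`). -/
def symValueR (K : SymCertR) : ℚ := symValue K.toSymCert

/-- The identity test with the EXECUTED canonicaliser of `…SymReplaySyntaxV` (`canonTermAV`, integer-pair corner);
`= identityOKR K` (`identityOKRV_eq`).  This is the form data files run by `native_decide`. -/
def identityOKRV (K : SymCertR) : Bool :=
  let N := residualR K
  let cP := minCornerP K.frame
  isZero (if K.useCanon then N.flatMap (canonTermAV cP K.frame) else N)

/-- **The executed R-checker**: `wellFormed K.expand && all gramBlockROK && identityOKRV K`; `= symCheckR K`. -/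
def symCheckRV (K : SymCertR) : Bool :=
  wellFormed K.expand && K.gramR.all (gramBlockROK K.frame) && identityOKRV K

/-- `identityOKRV = identityOKR` (by `canonTermAV_eq` / `mkSite_minCornerP_eq` of `…SyntaxV`). -/
theorem identityOKRV_eq (K : SymCertR) : identityOKRV K = identityOKR K := by
  unfold identityOKRV identityOKR
  simp only [canonTermAV_eq, mkSite_minCornerP_eq]

/-- **`symCheckRV = symCheckR`.** -/
theorem symCheckRV_eq (K : SymCertR) : symCheckRV K = symCheckR K := by
  unfold symCheckRV symCheckR
  rw [identityOKRV_eq]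

/-- Transfer lemma for data files. -/
theorem symCheckR_of_symCheckRV (K : SymCertR) (h : symCheckRV K = true) : symCheckR K = true := by
  rw [← symCheckRV_eq]; exact h

/-! ### Kernel toy: `E_Φ + 11/4 + 2 (N₀ − 7/8) ≡ 8 (c_↑c_↓)†(c_↑c_↓) + Σ_σ [(1/8) Q_σ Q_σ† + (1/32) q_σ† q_σ]`
modulo licensed moves, with `Q_σ = Σ_{δ} c_{δσ}`, `q_σ = Σ_{γ ∈ D₄} α_γ(c_{0σ} − c_{e₁σ}) = 8 c_{0σ} − 2 Q_σ`;
the two `q`-squares shipped as ONE-COLUMN R-BLOCKS (representative `c_{0σ} − c_{e₁σ}`, eight moves, `χ = 1`):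
the checker expands `2 × 5` products per block instead of `5 × 5`.  Value `−11/4`. -/

/-- The eight point-group moves about the origin, trivial character. -/
def d4MovesTriv : List RMove := d4All.map fun γ => ⟨γ, ![0, 0], 1⟩

/-- The toy R-certificate (value `−11/4`). -/
def toyRCert : SymCertR where
  frame := frame3
  inner := []
  mu := -2
  c := (-11) / 4
  gram := (8, [(1, [ann 0 0, ann 0 1])]) ::
    (([0, 1] : List (Fin 2)).map fun σ =>
      ((1 : ℚ) / 8, [e1, e2, -e1, -e2].map fun y => ((1 : ℚ), [cre y σ])))
  gramM := []
  eom := []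
  moves := []
  charged := []
  wardP := []
  wardM := []
  antiH := []
  slack := []
  useCanon := true
  gramR := ([0, 1] : List (Fin 2)).map fun σ =>
    { scale := 1 / 32, moves := d4MovesTriv, reps := [[(1, [ann 0 σ]), (-1, [ann e1 σ])]], rows := [[(1, 0)]] }

/-- The toy passes the R-checker (kernel). -/
theorem toyRCert_check : symCheckR toyRCert = true := by decide +kernel

/-- The same through the executed (V) identity test. -/
theorem toyRCert_checkV : symCheckRV toyRCert = true := by decide +kernel

/-- Its value. -/
theorem toyRCert_value : symValueR toyRCert = (-11) / 4 := by decide +kernel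

/-- The lever is load-bearing: without the canonicaliser the representative form does NOT close
(`P_B − 8·D_B` is a sum of genuine identification uses). -/
example : symCheckR { toyRCert with useCanon := false } = false := by decide +kernel

end SyntaxR

end Summit.Ventures.CertifiedManyBodySolver.Theorems.SymReplay
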